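import Literature.NumberTheory.LFunctions.FordProgram1
import HarnessLib

/-!
# Ford's "Program 1": kernel run 13B (`656 ≤ k ≤ 664`)

Topic `Literature/NumberTheory/LFunctions`. Everything here is PROVED (kernel evaluations, standard
axioms): `FordP1.checkT k = true` for `656 ≤ k ≤ 664`, i.e. the certified re-run of PROGRAM 1 of
K. Ford, Proc. LMS 85 (2002) (the second part of Theorem 3) for these `k` — see `FordProgram1.lean`
for the checker, its soundness `FordP1.row_of_checkK`, and the meaning of the constants
(`ρ = FordP1.rhoOf k / 10⁵`, `θ = FordP1.thetaOf k / 10⁴`, `ω = FordP1.omOf k / 10⁴`). One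
`decide +kernel` per `k` (so that the kernel's evaluation state is bounded by a single run;
`maxHeartbeats 0` lifts the deterministic time-out for each), then the range statement
`FordP1.run13B`. The assembly is `FordTheorem3SmallK.lean`.

## References

* K. Ford, Proc. London Math. Soc. (3) 85 (2002), 565–633; arXiv:1910.08209: Theorem 3, (1.7),
  Lemmas 3.4–3.5, Appendix "PROGRAM 1". [Ford2002]
-/

namespace Literature.NumberTheory.LFunctions
namespace FordP1

set_option maxHeartbeats 0 in
/-- `checkT 656`. [cite: Ford2002, Theorem 3 (second part) and PROGRAM 1] -/
theorem checkT_656 : checkT 656 = true := by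
  decide +kernel

set_option maxHeartbeats 0 in
/-- `checkT 657`. [cite: Ford2002, Theorem 3 (second part) and PROGRAM 1] -/
theorem checkT_657 : checkT 657 = true := by
  decide +kernel

set_option maxHeartbeats 0 in
/-- `checkT 658`. [cite: Ford2002, Theorem 3 (second part) and PROGRAM 1] -/
theorem checkT_658 : checkT 658 = true := by
  decide +kernel

set_option maxHeartbeats 0 in
/-- `checkT 659`. [cite: Ford2002, Theorem 3 (second part) and PROGRAM 1] -/
theorem checkT_659 : checkT 659 = true := by
  decide +kernel

set_option maxHeartbeats 0 in
/-- `checkT 660`. [cite: Ford2002, Theorem 3 (second part) and PROGRAM 1] -/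
theorem checkT_660 : checkT 660 = true := by
  decide +kernel

set_option maxHeartbeats 0 in
/-- `checkT 661`. [cite: Ford2002, Theorem 3 (second part) and PROGRAM 1] -/
theorem checkT_661 : checkT 661 = true := by
  decide +kernel

set_option maxHeartbeats 0 in
/-- `checkT 662`. [cite: Ford2002, Theorem 3 (second part) and PROGRAM 1] -/
theorem checkT_662 : checkT 662 = true := by
  decide +kernel

set_option maxHeartbeats 0 in
/-- `checkT 663`. [cite: Ford2002, Theorem 3 (second part) and PROGRAM 1] -/
theorem checkT_663 : checkT 663 = true := by
  decide +kernel

set_option maxHeartbeats 0 in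
/-- `checkT 664`. [cite: Ford2002, Theorem 3 (second part) and PROGRAM 1] -/
theorem checkT_664 : checkT 664 = true := by
  decide +kernel

/-- **Kernel run 13B**: `checkT k` for `656 ≤ k ≤ 664`. [cite: Ford2002, Theorem 3 (second part)
and PROGRAM 1] -/
theorem run13B (k : ℕ) (h1 : 656 ≤ k) (h2 : k ≤ 664) : checkT k = true := by
  interval_cases k
  · exact checkT_656
  · exact checkT_657
  · exact checkT_658
  · exact checkT_659
  · exact checkT_660
  · exact checkT_661
  · exact checkT_662
  · exact checkT_663
  · exact checkT_664

end FordP1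
end Literature.NumberTheory.LFunctions
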